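import Summits.QuantumFields.BalabanUV.T4Continuum.Spine.NE1p.DressedSmallFieldNestedToriTower

/-!
# T⁴ programme, spine estimate NE1′ (node O3b/H2) — THE TOWER, PART 2 of 3: S44's NESTED-TORI END FIRES OFF THE BOUNDARY ON BOTH COUNTS
# (`r₁ = ½`, `X₀ = C_R` of torus tree length ONE; conclusion factor `e^{−½·d(C_R)} = e^{−1∕2} < 1`, closed form `K₀(64,8)·e^{−3}`); the
# activity in closed form, its attached part NOT zero

Cell `pub-balaban`, sub-cell `t4`, BINDER-OWNERS row NE1′; crew `b2b-balaban-t4-ne1p-formalise-*`, row **W75 ∕ DAG N29zzzzd** of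
`t4/formal/NE1p/LEAVES.md` (INTENT `HOME/CLAIMS.log` l.22679, RESERVED typer R-T139 l.22796, STAGED l.22850), unit
`b2b-balaban-t4-ne1p-formalise-leaf-10` (gen 12).  PART 2 of 3 — imports PART 1
`Spine/NE1p/DressedSmallFieldNestedToriTower` ONLY and re-enters its namespace; toy DATA `def`s (the majorant `majT` at `v′`, the Cauchy
weights `cT`, the cores `GT`, the activity `actT`) + theorems; 0 `def … : Prop`, 0 cite, 0 sorry, 0 `attribute`; S44's END
`DressedSmallFieldNestedTori.attachedPart_locE_le_of_coresAt_pencil_components_nestedTori` applied EXACTLY ONCE BY NAME (`towerEnd_fires`);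
nothing of S44 ∕ W24 ∕ W33 ∕ W35 ∕ W41 ∕ W59 ∕ W67 ∕ S40.1 ∕ pv22 restated.

* §5 the majorant `maj′ l := v′^{#W′}·Π_{x ∈ F.attach} ε·m (p x).1 (p x).2` (S44's `hAmp` shape AT `v := v′`): `maj′ covered = ε³` (three centre
  cubes of weight `1`), `maj′ uncovered = v′³`; the cores `coreW (c′ l) r` with `c′ l := (cM r∕2)·e^{−5∕2}·maj′ l` — the Cauchy weight
  CARRIES the `e^{−5∕2}` the shrunk slope demands; **`hAmp_T`** in S44's LITERAL binder shape at `(A₀, A₁, ϱ) = (0, A₁′, 2)` and NE5's toy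
  letters `(1, 0, 1)` (W35 `letterMass_coreW`, W41 `budget_half` BY NAME);
* §6 **`towerEnd_fires`** — S44's END ONCE at `(L, N′) := (L, L·M)` (`5 ≤ L` feeding its `3 ≤ L`), `X₀ := CR L M`, `I := univ : Finset Unit`,
  `m := mN`, `bsel := (·).2.1.choose`, `(ε, c₀, R₀, r, R, c′, v) := (εN, 0, R₀N, rN, RN, 5, v′)`, `Rkp := Rkp′`, `(A₀, A₁, ϱ, r₁) :=
  (0, A₁′, 2, ½)`, PART 1's `hrate_T`∕`hRR_T`∕`hsmall_T`∕`hadm_T`, W59.1's `hκ_N_eq`∕`hκR_N`∕`hrate2_N_eq`∕`h229_N_eq`∕`hinner_N_eq` BY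
  NAME, **`hlink := link_torus' 4 (L·M)`** (S40.1), W33's `ctr0`∕`hroom0`, the pencil's two radius inequalities; conclusion LITERAL with
  the factor `exp (−(½ · torusTreeLen (CR L M).1))`; **`towerEnd_fires_closed : … ≤ K₀(64,8)·e^{−3}`** (`torusTreeLen_CR = 1`: the slope's
  prepaid `e^{−5∕2}` TIMES the COLLECTED `e^{−1∕2}`; W59∕W67 at the boundary read `K₀(64,8)·e⁰`); `decayFactor_lt_one`;
* §7 `actT_of_ne` (the activity lives, among ALL coarse polymers, on the rod `C_R` only), `actT_CR` (closed form — ONE common integral, W41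
  `termAt_coreW_pencil`), `actT_real_sub_zero`, **`actT_live`** (W33 `integral_incr_pos`, `0 < r`), `norm_actT_CR_lt_one` (W41
  `norm_term_le`, W24 `dressedConst_le_one`).  PART 3 (`…NestedToriTowerLive`) turns `actT_live` into `E₁(C_R) ≠ E₀(C_R)` by
  leaf-09's single-support lemma `DressedSmallFieldRodRateWitness.exp_locE_of_support_single`.

WHAT THE MOVE OFF THE BOUNDARY COSTS (said, not hidden).  On a FIXED activity the bookkeeping REDISTRIBUTES: `r₁ = ½` is admissible only
because `v` is halved and the slope and the cores carry `e^{−5∕2}`; the closed bound `K₀·e^{−3}` is smaller than W67's `K₀` for an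
activity that is itself `e^{−5∕2}`-smaller; NOTHING here improves a constant for a given density (leaf-09-g13's rod-rate row makes the same
point at N0o's one-torus face).  HONEST FRAMING as PART 1: a DECIDED TOY over S44's hypothesis SHAPES + by-name composition ([folklore]∕
[arith]); rod, centre cubes, labels, rates and numerals OURS in S44's literal currency; `hinner` CHOSEN (W59's `mN`); (B1b) NOT claimed;
(B3-amp) by CHOSEN weights — UNPRINTED for Bałaban's cores (G-ne9p2-5); print's ½L, (L+2)⁴, «L odd > 11», (1.28), (2.27), (2.35)–(2.41)
TYPE∕CONTEXT only; WHICH tori are Bałaban's = pv22's READING (D-pv22.3); 0 binders instantiated on Bałaban's densities; no wall item; wall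
v1.8 (T4-DAG v48) — words, not kind — does NOT move; R-t4r2-Q2 NOT met; NE1′ ⇐ the named binders — NOT proved, NOT printed; spine PROVED
0∕9; count 9 unchanged; ABSOLUTE RULE honoured.  Rung (B)+1 on ONE finite four-torus — NOT infinite volume, NOT a mass gap, NOT OS on ℝ⁴,
NOT Clay.  HONEST DEPENDENCY: continuum YM on T⁴ ⇐ BetaPertH ∧ nine spine estimates (0/9 proved); BetaPertH ⇐ (D1) ∧ (D4) ∧ CAP+tail;
G-an2-4 gates asym, D1 and NE2/3/4.
-/

noncomputable section

namespace Summit.QuantumFields.BalabanUV.T4Continuum.NE1p.DressedSmallFieldNestedToriTower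

open Set Metric MeasureTheory Complex
open scoped BigOperators
open Literature.MathematicalPhysics.QuantumFieldTheory.Balaban1983to89
open Literature.MathematicalPhysics.QuantumFieldTheory.Balaban1983to89.B12TreeDecay (K₀ K₀_pos)
open Literature.MathematicalPhysics.QuantumFieldTheory.Balaban1983to89.B13Resummation (locE)
open Literature.MathematicalPhysics.QuantumFieldTheory.Balaban1983to89.TreeLengthTorus (TPt TDom tsys torusTreeLen)
open Literature.MathematicalPhysics.QuantumFieldTheory.Balaban1983to89.TreeLengthTorusGeometry (tgeometry TTouch)
open Summit.QuantumFields.BalabanUV.T4Continuum.B13HistMeasurable (B13HistM)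
open Summit.QuantumFields.BalabanUV.T4Continuum.B13HistWitness (toyFrame)
open Summit.QuantumFields.BalabanUV.T4Continuum.B13TermParamGaussianBi (BiCore)
open Summit.QuantumFields.BalabanUV.T4Continuum.NE1p.DressedSmallFieldTorusWitness (dressedConst_le_one)
open Summit.QuantumFields.BalabanUV.T4Continuum.NE1p.DressedSmallFieldCoresWitness (E1 crd liveTable norm_liveTable_le coreW N₁_coreW
  ctr0 hroom0 Acst Acst_pos incr integral_incr_pos)
open Summit.QuantumFields.BalabanUV.T4Continuum.NE1p.DressedSmallFieldCoresMassWitness (letterMass_coreW cM cM_pos)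
open Summit.QuantumFields.BalabanUV.T4Continuum.NE1p.DressedSmallFieldDepCoresWitness (budget_half termAt_coreW_pencil
  closedForm_real_sub_zero norm_term_le)
open Summit.QuantumFields.BalabanUV.T4Continuum.NE1p.DressedSmallFieldInnerLink (link_torus')
open Summit.QuantumFields.BalabanUV.T4Continuum.NE1p.DressedSmallFieldNestedTori
  (attachedPart_locE_le_of_coresAt_pencil_components_nestedTori)
open Summit.QuantumFields.BalabanUV.T4Continuum.NE1p.DressedSmallFieldNestedToriWitness (rN RN vN R₀N εN εN_pos vN_pos hκ_N_eq
  hrate2_N_eq hκR_N h229_N_eq mN mN_nonneg hinner_N_eq LabelN εN_le_one)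
open Summit.QuantumFields.BalabanUV.T4Continuum.NE1p.DressedSmallFieldNestedToriRod (CR CR_val torusTreeLen_CR)

section Datum
variable (L M : ℕ) [NeZero L] [NeZero M]

/-! ## §5 THE MAJORANTS, THE CORES, THE ACTIVITY, S44's `hAmp` -/

/-- S44's table-blind majorant of a label AT THE HALVED LETTER `v′` (toy DATA): `v′^{#W′}·Π_{x∈F.attach} ε·m (p x).1 (p x).2` — LITERALLY
the shape in S44's `hAmp` at `v := v′`. [folklore] -/
def majT (l : LabelN L (L * M)) : ℝ := vT ^ l.1.card * ∏ x ∈ l.2.1.attach, (εN L * mN L (L * M) (l.2.2 x.1 x.2).1 (l.2.2 x.1 x.2).2)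

/-- `0 ≤ maj′`. [arith] -/
theorem majT_nonneg (l : LabelN L (L * M)) : 0 ≤ majT L M l :=
  mul_nonneg (pow_nonneg vT_pos.le _) (Finset.prod_nonneg fun _ _ => mul_nonneg (εN_pos L).le (mN_nonneg L (L * M) _ _))

/-- At a centre cube the inner weight is `1` (tree length `0`). [arith] -/
theorem mN_Cctr (b : TPt 4 (L * M)) (u : Unit) : mN L (L * M) (Cctr L M b) u = 1 := by
  unfold mN; rw [torusTreeLen_Cctr, mul_zero, neg_zero, Real.exp_zero]

/-- **THE COVERED LABEL WEIGHS `ε³`** (three members, each a centre cube of weight `1`). [arith] -/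
theorem majT_coveredT (hL : 5 ≤ L) : majT L M (coveredT L M) = εN L ^ 3 := by
  unfold majT coveredT
  rw [Finset.card_empty, pow_zero, one_mul,
    Finset.prod_attach (F3 L M) (fun Z => εN L * mN L (L * M) (Cctr L M Z.2.1.choose) ())]
  simp only [mN_Cctr, mul_one]
  rw [Finset.prod_const, card_F3 L M hL]

/-- **THE UNCOVERED LABEL WEIGHS `v′³`** (three uncovered cubes, empty product). [arith] -/
theorem majT_uncoveredT (hL : 5 ≤ L) : majT L M (uncoveredT L M) = vT ^ 3 := by
  unfold majT uncoveredT
  rw [Finset.attach_empty, Finset.prod_empty, mul_one, CR_val, card_rodT L M hL]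

variable (r : ℝ) (hr : 0 ≤ r)

/-- THE LABEL-DEPENDENT CAUCHY WEIGHT CARRYING `e^{−5∕2}` (toy DATA): `c′ l := (cM r∕2)·e^{−5∕2}·maj′ l`. [folklore] -/
def cT (l : LabelN L (L * M)) : ℝ := cM r / 2 * Real.exp (-(5 / 2)) * majT L M l

/-- THE LABEL-INDEXED CORE FAMILY (toy DATA): W33's one-label core `coreW` at the weight `c′ l`. [folklore] -/
def GT : ∀ (_ : ℕ) (_ : LabelN L (L * M)), ℕ → BiCore toyFrame (fun _ : Unit => (0 : ℕ)) ℂ Unit E1 :=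
  fun _ l _ => coreW (cT L M r l) r hr

/-- The core at `(k, l, X)`. [folklore] -/
@[simp] theorem GT_apply (k : ℕ) (l : LabelN L (L * M)) (X : ℕ) : GT L M r hr k l X = coreW (cT L M r l) r hr := rfl

/-- THE ACTIVITY OF RECORD (toy DATA): the cores' terms summed over the index along W33's pencil `s ↦ 0 + s • liveTable`; it lives on the
ROD polymer only (`termsT_of_ne`). [folklore] -/
def actT (k : ℕ) (s : ℂ) (Z : (tsys 4 (L * M)).Dom) : ℂ :=
  ∑ l ∈ termsT L M Z, (GT L M r hr k l k).termAt (0 : ℂ) ((0 : B13HistM toyFrame) + s • liveTable)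

/-- **`hAmp` MET AT THE SHRUNK SLOPE** [decided toy], in S44's LITERAL binder shape at NE5's toy letters `(1, 0, 1)`, `ϱ = 2`, `A₀ = 0`,
`A₁ = A₁′`: `maj′ l·e^{−5∕2}·|cM r∕2|·√(2π)·e^{r·2‖liveTable‖} ≤ (0 + 2·A₁′)·maj′ l` (W35 `letterMass_coreW`, W41 `budget_half`). [folklore] -/
theorem hAmp_T (k : ℕ) :
    ∀ Z : (tsys 4 (L * M)).Dom, Z.1 ⊆ (CR L M).1 → ∀ l ∈ termsT L M Z,
      (GT L M r hr k l k).lam.real univ *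
          ((GT L M r hr k l k).wB * (fun (_ : ℕ) (_ : LabelN L (L * M)) (_ : ℕ) => (1 : ℝ)) k l k *
            Real.exp ((fun (_ : ℕ) (_ : LabelN L (L * M)) (_ : ℕ) => (0 : ℝ)) k l k)) *
          (Real.pi / ((fun (_ : ℕ) (_ : LabelN L (L * M)) (_ : ℕ) => (1 : ℝ)) k l k / 2)) ^ (Module.finrank ℝ E1 / 2 : ℝ) *
        Real.exp ((GT L M r hr k l k).N₁ * (‖(0 : B13HistM toyFrame)‖ + 2 * ‖liveTable‖)) ≤
      (0 + 2 * A₁T) * (vT ^ l.1.card * ∏ x ∈ l.2.1.attach, (εN L * mN L (L * M) (l.2.2 x.1 x.2).1 (l.2.2 x.1 x.2).2)) := by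
  intro Z _ l _
  simp only [GT_apply]
  rw [letterMass_coreW, N₁_coreW, norm_zero, zero_add]
  have hp : 0 ≤ majT L M l := majT_nonneg L M l
  have hT : 2 * ‖liveTable‖ ≤ 2 := by linarith [norm_liveTable_le]
  have hb := budget_half r hr hT
  have he : 0 ≤ Real.exp (-(5 / 2 : ℝ)) := (Real.exp_pos _).le
  show |cT L M r l| * Real.sqrt (2 * Real.pi) * Real.exp (r * (2 * ‖liveTable‖)) ≤ (0 + 2 * A₁T) * majT L M l
  unfold cT A₁T
  rw [abs_mul, abs_of_nonneg hp, abs_mul, abs_of_nonneg he]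
  calc |cM r / 2| * Real.exp (-(5 / 2)) * majT L M l * Real.sqrt (2 * Real.pi) * Real.exp (r * (2 * ‖liveTable‖))
      = majT L M l * Real.exp (-(5 / 2)) * (|cM r / 2| * Real.sqrt (2 * Real.pi) * Real.exp (r * (2 * ‖liveTable‖))) := by ring
    _ ≤ majT L M l * Real.exp (-(5 / 2)) * (Acst / 2) := mul_le_mul_of_nonneg_left hb (mul_nonneg hp he)
    _ = (0 + 2 * (Acst * Real.exp (-(5 / 2)) / 4)) * majT L M l := by ring

/-! ## §6 THE END FIRES OFF THE BOUNDARY ON BOTH COUNTS -/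

open Classical in
/-- **S44's `attachedPart_locE_le_of_coresAt_pencil_components_nestedTori` FIRES ON THE TOWER AT `r₁ = ½` AND AT A COARSE POLYMER OF
TREE LENGTH ONE** [decided toy]: coarse torus `tsys 4 (L·M)`, FINE torus `tsys 4 (L·(L·M))`, `X₀ := C_R` (W67's rod), `I := univ : Finset Unit`,
`m := mN`, `bsel := (·).2.1.choose`, `(ε, c₀, R₀, r, R, c′, v) := (εN, 0, R₀N, rN, RN, 5, v′)`, `Rkp := Rkp′`, `(A₀, A₁, ϱ, r₁) := (0, A₁′, 2, ½)`,
W59.1's `hκ`∕`hκR`∕`hrate2`∕`h229`∕`hinner` BY NAME, §1's `hrate_T`∕`hRR_T`∕`hsmall_T`, `hlink := link_torus' 4 (L·M)` (S40.1), `hadm_T`, `hAmp_T`;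
`5 ≤ L` feeds S44's `3 ≤ L`.  Conclusion LITERAL, with the factor `exp (−(½ · torusTreeLen C_R))`. [folklore] -/
theorem towerEnd_fires (hL : 5 ≤ L) (k : ℕ) :
    ‖locE (TTouch (d := 4) (N := L * M)) (fun Z : (tsys 4 (L * M)).Dom => Z.1) (actT L M r hr k 1) (CR L M).1 -
        locE (TTouch (d := 4) (N := L * M)) (fun Z : (tsys 4 (L * M)).Dom => Z.1) (actT L M r hr k 0) (CR L M).1‖ ≤
      4 * (Real.exp 1 * 9 * 64 * K₀ 64 8 ^ 2) * A₁T * Real.exp (-(1 / 2 * torusTreeLen (CR L M).1)) :=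
  have h3 : 3 ≤ L := by omega
  attachedPart_locE_le_of_coresAt_pencil_components_nestedTori h3 (GT L M r hr)
    (Win := Set.univ) (ctr := ctr0) (ROp := fun _ => 1) (RHist := fun _ => 2) (R' := fun _ => 2)
    (mq := fun _ _ _ => 1) (bq := fun _ _ _ => 0) (N₀ := fun _ _ _ => 1)
    hroom0 (fun _ _ _ _ _ _ _ => one_pos)
    (fun _ _ _ _ _ _ _ => ⟨fun _ _ => aestronglyMeasurable_const, fun _ => differentiableOn_const _, fun _ _ _ => by
      show ‖(1 : ℂ)‖ ≤ 1; rw [norm_one]⟩)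
    (fun _ _ _ _ _ _ _ => ⟨fun _ _ => (Complex.measurable_ofReal.comp (measurable_snd.norm.pow_const 2)).aestronglyMeasurable,
      fun _ _ => differentiableOn_const _, fun _ _ _ v => by
        show 1 * ‖v‖ ^ 2 - 0 ≤ (((‖v‖ ^ 2 : ℝ) : ℂ)).re; rw [Complex.ofReal_re]; simp⟩)
    (g := fun _ => 0) (Set.mem_univ _) (U := ()) (o := 0) (h₀ := 0) (w := liveTable) (ϱ := 2)
    (by show ‖(0 : ℂ) - 0‖ ≤ 1; simp)
    (by show ‖(0 : B13HistM toyFrame) - 0‖ + 2 * ‖liveTable‖ ≤ 2; rw [sub_zero, norm_zero, zero_add];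
        linarith [norm_liveTable_le])
    (emb := fun _ => k) (fun _ => rfl) (terms := termsT L M) (act := actT L M r hr k) (fun _ _ _ => rfl)
    (A₀ := 0) (A₁ := A₁T) (r₁ := 1 / 2) (CR L M)
    le_rfl A₁T_pos.le (by norm_num) hrate_T hsmall_T
    (fun _ => (Finset.univ : Finset Unit)) (mN L (L * M)) (mN_nonneg L (L * M)) (fun Z' => Z'.2.1.choose)
    (fun Z' => Z'.2.1.choose_spec)
    (ε := εN L) (c₀ := 0) (R₀ := R₀N L) (r := rN) (R := RN) (c' := 5) (v := vT)
    (εN_pos L).le vT_pos.le (fun Z₀ => (hinner_N_eq L (L * M) Z₀).le) (hκR_N L h3) (hrate2_N_eq L h3).le hκ_N_eq.le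
    (h229_N_eq L).le (link_torus' 4 (L * M)) hRR_T (hadm_T L M hL) (hAmp_T L M r hr k) le_rfl
    (by have := A₁T_pos; linarith)

open Classical in
/-- **… IN CLOSED FORM: `≤ K₀(64,8)·e^{−3}`** — the slope's prepaid `e^{−5∕2}` TIMES the COLLECTED decay `e^{−½·d(C_R)} = e^{−1∕2}`
(`torusTreeLen_CR = 1` BY NAME); W59∕W67 at the boundary read `K₀(64,8)·e⁰`. [folklore] -/
theorem towerEnd_fires_closed (hL : 5 ≤ L) (k : ℕ) :
    ‖locE (TTouch (d := 4) (N := L * M)) (fun Z : (tsys 4 (L * M)).Dom => Z.1) (actT L M r hr k 1) (CR L M).1 -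
        locE (TTouch (d := 4) (N := L * M)) (fun Z : (tsys 4 (L * M)).Dom => Z.1) (actT L M r hr k 0) (CR L M).1‖ ≤
      K₀ 64 8 * Real.exp (-3) := by
  refine (towerEnd_fires L M r hr hL k).trans (le_of_eq ?_)
  rw [torusTreeLen_CR L M hL, mul_one]
  unfold A₁T Acst
  have hK := K₀_pos (64 : ℝ) 8
  have he := Real.exp_pos 1
  have h3 : Real.exp (-(5 / 2 : ℝ)) * Real.exp (-(1 / 2)) = Real.exp (-3) := by rw [← Real.exp_add]; norm_num
  rw [← h3]
  field_simp

/-- **THE DECAY FACTOR IS STRICTLY BELOW ONE**: `e^{−½·d(C_R)} = e^{−1∕2} < 1` — off the boundary on BOTH counts (rate `½ > 0`, length `1 > 0`). [arith] -/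
theorem decayFactor_lt_one (hL : 5 ≤ L) : Real.exp (-(1 / 2 * torusTreeLen (CR L M).1)) < 1 := by
  rw [torusTreeLen_CR L M hL, mul_one]; exact Real.exp_lt_one_iff.2 (by norm_num)

end Datum

section Live
variable (L M : ℕ) [NeZero L] [NeZero M] (r : ℝ) (hr : 0 ≤ r)

/-! ## §7 THE ACTIVITY LIVES ON THE ROD ONLY; its closed form; the attached part is NOT zero -/

/-- **OFF THE ROD THE ACTIVITY VANISHES** (the index is empty there) — among the polymers inside `C_R` the activity is supported on the ONE
polymer `C_R` of footprint `C_R`: the single-support situation of leaf-09's `exp_locE_of_support_single`. [folklore] -/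
theorem actT_of_ne {Z : (tsys 4 (L * M)).Dom} (h : Z ≠ CR L M) (k : ℕ) (s : ℂ) : actT L M r hr k s Z = 0 := by
  unfold actT; rw [termsT_of_ne L M h, Finset.sum_empty]

open Classical in
/-- **EXACTLY TWO LABELS AT THE ROD**. [folklore] -/
theorem termsT_CR_card : (termsT L M (CR L M)).card = 2 := by
  rw [termsT_CR, Finset.card_insert_of_notMem (by rw [Finset.mem_singleton]; exact coveredT_ne_uncoveredT L M),
    Finset.card_singleton]

open Classical in
/-- **THE MAJORANT MASS OF THE ROD**: `Σ_l maj′ l = ε³ + v′³`. [arith] -/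
theorem majT_sum_CR (hL : 5 ≤ L) : ∑ l ∈ termsT L M (CR L M), majT L M l = εN L ^ 3 + vT ^ 3 := by
  rw [termsT_CR, Finset.sum_insert (by rw [Finset.mem_singleton]; exact coveredT_ne_uncoveredT L M), Finset.sum_singleton,
    majT_coveredT L M hL, majT_uncoveredT L M hL]

/-- `0 < ε³ + v′³`. [arith] -/
theorem mass_pos : 0 < εN L ^ 3 + vT ^ 3 := by
  have := pow_pos (εN_pos L) 3; have := pow_pos vT_pos 3; linarith

/-- `e^{−5∕2}·(ε³ + v′³) ≤ 1 + 1∕64` (crudely: `ε ≤ 1`, `v′ ≤ 1∕128`, `e^{−5∕2} ≤ 1`). [arith] -/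
theorem scaledMass_le : Real.exp (-(5 / 2)) * (εN L ^ 3 + vT ^ 3) ≤ 1 + 1 / 64 := by
  have hε0 := (εN_pos L).le
  have hε1 := εN_le_one L
  have hv0 := vT_pos.le
  have hv1 : vT ≤ 1 := by linarith [vT_le]
  have hε3 : εN L ^ 3 ≤ 1 := pow_le_one₀ hε0 hε1
  have hv3 : vT ^ 3 ≤ vT := by
    calc vT ^ 3 = vT * (vT * vT) := by ring
      _ ≤ vT * (1 * 1) := by gcongr
      _ = vT := by ring
  have he : Real.exp (-(5 / 2 : ℝ)) ≤ 1 := Real.exp_le_one_iff.2 (by norm_num)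
  have hm : 0 ≤ εN L ^ 3 + vT ^ 3 := (mass_pos L).le
  calc Real.exp (-(5 / 2)) * (εN L ^ 3 + vT ^ 3) ≤ 1 * (εN L ^ 3 + vT ^ 3) := mul_le_mul_of_nonneg_right he hm
    _ ≤ 1 + 1 / 64 := by linarith [vT_le]

open Classical in
/-- **THE ACTIVITY AT THE ROD IN CLOSED FORM**: `act k s C_R = (cM r∕2)·e^{−5∕2}·(ε³ + v′³)·∫ e^{s·r·e^{−(v 0)²}}·e^{−‖v‖²} dv` (W41
`termAt_coreW_pencil`, ONE common integral; `majT_sum_CR`). [folklore] -/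
theorem actT_CR (hL : 5 ≤ L) (k : ℕ) (s : ℂ) :
    actT L M r hr k s (CR L M) = ((cM r / 2 * Real.exp (-(5 / 2)) * (εN L ^ 3 + vT ^ 3) : ℝ) : ℂ) *
      ∫ v : E1, cexp (s * ((r : ℂ) * (Real.exp (-(crd v ^ 2)) : ℂ))) * cexp (-(((‖v‖ ^ 2 : ℝ) : ℂ))) := by
  unfold actT
  simp only [GT_apply, termAt_coreW_pencil]
  rw [← Finset.sum_mul, ← majT_sum_CR L M hL, Finset.mul_sum]
  push_cast
  unfold cT
  push_cast
  rfl

/-- The increment between a REAL source `t` and `0` at the rod (W41 `closedForm_real_sub_zero`). [folklore] -/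
theorem actT_real_sub_zero (hL : 5 ≤ L) (k : ℕ) (t : ℝ) :
    actT L M r hr k (t : ℂ) (CR L M) - actT L M r hr k 0 (CR L M) =
      ((cM r / 2 * Real.exp (-(5 / 2)) * (εN L ^ 3 + vT ^ 3) : ℝ) : ℂ) * ((∫ v, incr (t * r) v : ℝ) : ℂ) := by
  rw [actT_CR L M r hr hL, actT_CR L M r hr hL]
  exact closedForm_real_sub_zero _ r hr t

/-- **THE ATTACHED PART OF THE ACTIVITY IS NOT ZERO** (`(cM r∕2)·e^{−5∕2}·(ε³ + v′³) > 0`, W33's `∫ incr r > 0` for `0 < r`). [folklore] -/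
theorem actT_live (hL : 5 ≤ L) (hr0 : 0 < r) (k : ℕ) : actT L M r hr k 1 (CR L M) ≠ actT L M r hr k 0 (CR L M) := by
  intro h
  have h0 := sub_eq_zero.2 h
  rw [show (1 : ℂ) = ((1 : ℝ) : ℂ) from Complex.ofReal_one.symm, actT_real_sub_zero L M r hr hL, one_mul] at h0
  have hc : 0 < cM r / 2 * Real.exp (-(5 / 2)) * (εN L ^ 3 + vT ^ 3) :=
    mul_pos (mul_pos (half_pos (cM_pos r)) (Real.exp_pos _)) (mass_pos L)
  rcases mul_eq_zero.1 h0 with hc0 | hI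
  · exact hc.ne' (by exact_mod_cast hc0)
  · exact (integral_incr_pos r hr0).ne' (by exact_mod_cast hI)

/-- The activities at the rod lie STRICTLY inside the unit disc for `‖s‖ ≤ 2` (`e^{−5∕2}(ε³ + v′³) ≤ 65∕64`, W41 `norm_term_le`, `A ≤ 1`,
`√π∕√(2π) < 1`). [folklore] -/
theorem norm_actT_CR_lt_one (hL : 5 ≤ L) (k : ℕ) {s : ℂ} (hs : ‖s‖ ≤ 2) : ‖actT L M r hr k s (CR L M)‖ < 1 := by
  rw [actT_CR L M r hr hL]
  set μ : ℝ := Real.exp (-(5 / 2)) * (εN L ^ 3 + vT ^ 3) with hμ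
  have hμ0 : 0 ≤ μ := mul_nonneg (Real.exp_pos _).le (mass_pos L).le
  have hμ1 : μ ≤ 1 + 1 / 64 := scaledMass_le L
  have hπ : 0 < Real.sqrt Real.pi := Real.sqrt_pos.2 Real.pi_pos
  have hlt : Real.sqrt Real.pi < Real.sqrt (2 * Real.pi) := Real.sqrt_lt_sqrt Real.pi_pos.le (by linarith [Real.pi_pos])
  have hq : Real.sqrt Real.pi / Real.sqrt (2 * Real.pi) < 1 := (div_lt_one (hπ.trans hlt)).2 hlt
  have hq0 : 0 ≤ Real.sqrt Real.pi / Real.sqrt (2 * Real.pi) := by positivity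
  have hA : Acst ≤ 1 := dressedConst_le_one
  have hb := norm_term_le r hr hs
  have hn : ‖((cM r / 2 * Real.exp (-(5 / 2)) * (εN L ^ 3 + vT ^ 3) : ℝ) : ℂ) *
        ∫ v : E1, cexp (s * ((r : ℂ) * (Real.exp (-(crd v ^ 2)) : ℂ))) * cexp (-(((‖v‖ ^ 2 : ℝ) : ℂ)))‖ =
      μ * ‖((cM r / 2 : ℝ) : ℂ) * ∫ v : E1, cexp (s * ((r : ℂ) * (Real.exp (-(crd v ^ 2)) : ℂ))) * cexp (-(((‖v‖ ^ 2 : ℝ) : ℂ)))‖ := by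
    rw [norm_mul, norm_mul, Complex.norm_real, Complex.norm_real, Real.norm_eq_abs, Real.norm_eq_abs,
      show cM r / 2 * Real.exp (-(5 / 2)) * (εN L ^ 3 + vT ^ 3) = cM r / 2 * μ by rw [hμ]; ring, abs_mul, abs_of_nonneg hμ0]
    ring
  rw [hn]
  calc μ * ‖((cM r / 2 : ℝ) : ℂ) * ∫ v : E1, cexp (s * ((r : ℂ) * (Real.exp (-(crd v ^ 2)) : ℂ))) * cexp (-(((‖v‖ ^ 2 : ℝ) : ℂ)))‖
      ≤ (1 + 1 / 64) * (Acst / 2 * (Real.sqrt Real.pi / Real.sqrt (2 * Real.pi))) := mul_le_mul hμ1 hb (norm_nonneg _) (by norm_num)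
    _ < 1 := by
        have := Acst_pos
        nlinarith

end Live

end Summit.QuantumFields.BalabanUV.T4Continuum.NE1p.DressedSmallFieldNestedToriTower

end
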